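import Summits.QuantumAdvantage.Dequantization.CliffordFamilyRep
import Summits.QuantumAdvantage.Dequantization.CliffordDoubleModel

/-!
# The Hilbert–Schmidt ceiling of Clifford multiplication: `‖AB‖₂² ≤ 2^{⌈n/2⌉}‖A‖₂²‖B‖₂²` (DEQ-A118, Theorem A118-A)

HONEST FRAMING: instance-level adjudication of specific advantage claims; no claim about
BQP vs BPP or the summit.

Context (cell pub-qadeq, CLAIMS row A-118 = Muchane, *Quantum algorithm for Clifford
multiplication*, arXiv:2607.10473v1; adjudication `pub-qadeq-deq-1/DEQ-A118.md`, unit pub-qadeq-deq-1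
gen 19; this module answers its optional request LEAN (2) and is filed by the cell lead, harvest-1
gen 14).  In the blade-coefficient vocabulary of
`Literature.Computability.QuantumAlgorithms.CliffordTwistedConvolution` (the Clifford product of
`Cℓ_{p,q}(ℂ)`, `n = p + q`, IS the cocycle-twisted convolution `twConv (sigWeight ℂ p)`; the success
probability of the post-selected branch of Muchane's Theorem 2.5 is `p₀ = 2⁻ⁿ Σ_z |c_z|²` for
normalised inputs, `successProbability` there), we PROVE the adjudication's Theorem A118-A:

* `sum_norm_sq_twConv_le_ceil` : `Σ_z |c_z|² ≤ 2^{⌈n/2⌉} (Σ_x |a_x|²)(Σ_y |b_y|²)` for all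
  `a, b : (ℤ/2)ⁿ → ℂ` and every signature `p` — the square root of the Young-type bound `2ⁿ`
  (`CliffordProductEnvelope.sum_norm_sq_twConv_le`, the paper's p. 16);
* `successProbability_le_ceiling` : hence `p₀ ≤ 2^{−⌊n/2⌋}` for EVERY pair of normalised inputs,
  so one accepted copy of the product state costs `Ω(2^{⌊n/2⌋})` repetitions of the circuit
  (`Ω(2^{⌊n/2⌋/2})` rounds of amplitude amplification), never `polylog N`;
* `sum_norm_sq_twConv_le_pow` : the general form with any `k ≥ n/2`.
* `ceiling_attained_one` : the constant is sharp at `n = 1` (`a = b = e_∅ + e₁` in `Cℓ_{1,0}`: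
  `Σ|c_z|² = 8 = 2^{⌈1/2⌉}‖a‖₂²‖b‖₂²`); sharpness at every `n` (stabilizer idempotents) stays numerical.

## Proof (route (α) of DEQ-A118 §10, a `2ᵏ`-dimensional representation, `k = ⌈n/2⌉`)

1. (`rep`, §1) Any family `γ₁, …, γₙ` of pairwise anticommuting elements of a `ℂ`-algebra `R`
   with `γᵢ² = qᵢ` extends, by the universal property of Mathlib's `CliffordAlgebra` composed with
   the Albuquerque–Majid identification `toTwistedEquiv` of the Literature file, to a map
   `ρ : ℂ_F[(ℤ/2)ⁿ] → R` that is multiplicative for the twisted product (`rep_mul`), with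
   `ρ(e_x)ρ(e_y) = F(x,y)ρ(e_{x⊕y})` (`rep_blade_mul`); if `U` anticommutes with the `γᵢ`, `i ∈ S`,
   and commutes with the rest then `Uρ(e_x) = (−1)^{#(supp x ∩ S)} ρ(e_x)U` (`conj_sign`).
2. (§2) Elementary matrix facts: if `U² = ε·1 ≠ 0` and `UM = −MU` then `tr M = 0`
   (`trace_eq_zero_of_anticomm`); `Σ|T_{ij}|² = tr(T†T)`; the Frobenius norm is submultiplicative
   (Cauchy–Schwarz, `sum_norm_sq_mul_le`).
3. (§3) The model: on `ℂ_F[(ℤ/2)ᵏ]` with unit weights, the `2k` operators `L_{e_j}` and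
   `R_{e_j}∘α` (`α` the grade involution) pairwise anticommute and square to `±1`
   (`modelMat_anticomm`, `modelMat_mul_self`, from `gp_assoc` and the generator relations of the
   Literature file); as matrices they are signed permutations, hence unitary
   (`modelMat_mem_unitaryGroup`).
4. (§4) For `n ≤ 2k` and an injection `e : Fin n ↪ Fin k ⊕ Fin k`, the target family
   `γᵢ = phaseᵢ · Γ_{e i}` (`phaseᵢ ∈ {1, i}` fixing the sign of the square) realises `Cℓ_{p,q}`;
   every `ρ(e_x)` is unitary (`trep_blade_mem_unitaryGroup`), `ρ(e_z)` is traceless for `z ≠ 0`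
   (`trace_trep_blade`: conjugate by a `γᵢ`, or — when `z = 1ⁿ` with `n` odd, so that `n < 2k` — by a
   model matrix outside the family), so the blade images are Hilbert–Schmidt orthogonal with
   `tr(ρ(e_x)†ρ(e_y)) = 2ᵏ[x = y]` (`trace_star_trep_blade_mul`) and `‖ρ(a)‖_F² = 2ᵏ‖a‖₂²`
   (`sum_norm_sq_trep`).
5. (§5) `2ᵏ‖ab‖₂² = ‖ρ(a)ρ(b)‖_F² ≤ ‖ρ(a)‖_F²‖ρ(b)‖_F² = 4ᵏ‖a‖₂²‖b‖₂²`.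

No `sorry`, no named fact; the definitions (`famLift`, `rep`, `psgn`, `gradeInv`, `leftGen`,
`rightGen`, `Lm`, `Rm`, `Am`, `modelMat`, `modelSq`, `phase`, `tgt`, `trep`) are the proof's own
scaffolding.  Tightness (`p₀ = 2^{−⌊n/2⌋}` for the stabilizer idempotents
`∏ₖ(1 + wₖe_{2k−1}e_{2k})/√2`) is certified numerically in `NUMERICS-A118.md`, not formalised here.
-/

noncomputable section

open Finset
open Literature.Computability.QuantumAlgorithms.CliffordTwistedConvolution
open Summit.QuantumAdvantage.Dequantization.CliffordFamilyRep
open Summit.QuantumAdvantage.Dequantization.CliffordDoubleModel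

namespace Summit.QuantumAdvantage.Dequantization.CliffordNormCeiling

variable {n : ℕ}

/-! ### 4. The target family for `Cℓ_{p,q}(ℂ)` and the Hilbert–Schmidt computation -/

section Target

variable {k : ℕ} (p : ℕ) (e : Fin n ↪ Fin k ⊕ Fin k)

/-- The signature weights of `Cℓ_{p,q}` are `±1`. -/
theorem sigWeight_cases (i : Fin n) : sigWeight ℂ p i = 1 ∨ sigWeight ℂ p i = -1 := by
  unfold sigWeight; split_ifs <;> simp

/-- The phase `1` or `i` turning the model square `±1` into the required `eᵢ² = ±1`. -/
def phase (i : Fin n) : ℂ := if sigWeight ℂ p i = modelSq (e i) then 1 else Complex.I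

/-- The phase is unimodular (`1` or `i`). -/
theorem star_phase_mul_self (i : Fin n) : star (phase p e i) * phase p e i = 1 := by
  unfold phase; split_ifs <;> simp [Complex.conj_I]

/-- `phase² · (model square) = qᵢ`: the phase corrects the sign of the square. -/
theorem phase_sq (i : Fin n) : phase p e i * phase p e i * modelSq (e i) = sigWeight ℂ p i := by
  unfold phase
  have h1 : (1 : ℂ) ≠ -1 := by norm_num
  have h2 : (-1 : ℂ) ≠ 1 := by norm_num
  rcases sigWeight_cases p i with h | h <;> rcases modelSq_cases (e i) with h' | h' <;>
    simp [h, h', h1, h2, Complex.I_mul_I]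

/-- The target Clifford family `γᵢ = phaseᵢ · Γ_{e(i)}` in `M_{2ᵏ}(ℂ)`. -/
def tgt (i : Fin n) : Matrix (Blade k) (Blade k) ℂ := phase p e i • modelMat (e i)

/-- The target family anticommutes pairwise (`e` is injective). -/
theorem tgt_anticomm (i j : Fin n) (h : i ≠ j) : tgt p e i * tgt p e j + tgt p e j * tgt p e i = 0 := by
  simp only [tgt, smul_mul_smul_comm]
  rw [mul_comm (phase p e j), ← smul_add, modelMat_anticomm (e.injective.ne h), smul_zero]

/-- The target family has the prescribed squares `γᵢ² = qᵢ` of `Cℓ_{p,q}`. -/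
theorem tgt_mul_self (i : Fin n) :
    tgt p e i * tgt p e i = algebraMap ℂ (Matrix (Blade k) (Blade k) ℂ) (sigWeight ℂ p i) := by
  rw [tgt, smul_mul_smul_comm, modelMat_mul_self, smul_smul, Algebra.algebraMap_eq_smul_one, phase_sq]

/-- The target family consists of unitaries. -/
theorem tgt_mem_unitaryGroup (i : Fin n) : tgt p e i ∈ Matrix.unitaryGroup (Blade k) ℂ :=
  smul_mem_unitaryGroup (star_phase_mul_self p e i) (modelMat_mem_unitaryGroup (e i))

/-- The representation `ρ : ℂ_F[(ℤ/2)ⁿ] = Cℓ_{p,q}(ℂ) → M_{2ᵏ}(ℂ)`, `n ≤ 2k`. -/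
def trep (a : MV n ℂ) : Matrix (Blade k) (Blade k) ℂ :=
  rep (sigWeight ℂ p) (tgt p e) (tgt_anticomm p e) (tgt_mul_self p e) a

/-- Unfolding lemma for `trep`. -/
theorem trep_def (a : MV n ℂ) :
    trep p e a = rep (sigWeight ℂ p) (tgt p e) (tgt_anticomm p e) (tgt_mul_self p e) a := rfl

/-- Every blade image `ρ(e_x)` is unitary. -/
theorem trep_blade_mem_unitaryGroup (x : Blade n) : trep p e (bladeVec ℂ x) ∈ Matrix.unitaryGroup (Blade k) ℂ := by
  suffices h : ∀ (m : ℕ) (x : Blade n), (univ.filter fun i => x i = true).card = m →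
      trep p e (bladeVec ℂ x) ∈ Matrix.unitaryGroup (Blade k) ℂ from h _ x rfl
  intro m
  induction m with
  | zero =>
      intro x hx
      have hx0 : x = 0 := by
        funext i
        have : i ∉ univ.filter fun i => x i = true := by
          rw [Finset.card_eq_zero] at hx; rw [hx]; exact Finset.notMem_empty i
        simpa using this
      subst hx0
      rw [trep_def, rep_one]
      exact Submonoid.one_mem _
  | succ m ih =>
      intro x hx
      obtain ⟨i, hi⟩ : ∃ i, i ∈ univ.filter fun i => x i = true := by
        apply Finset.Nonempty.exists_mem
        rw [← Finset.card_pos, hx]; exact Nat.succ_pos m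
      have hxi : x i = true := by simpa using hi
      have hset : (univ.filter fun j => (x + gen i) j = true) =
          (univ.filter fun j => x j = true).erase i := by
        ext j
        by_cases hj : j = i
        · subst hj; simp [hxi, gen]
        · simp [gen, hj]
      have hcard : (univ.filter fun j => (x + gen i) j = true).card = m := by
        rw [hset, Finset.card_erase_of_mem hi, hx]; rfl
      rw [trep_def, rep_blade_peel _ _ _ _ x hxi]
      refine smul_mem_unitaryGroup (star_exchSign_mul_self _ _) (Submonoid.mul_mem _ ?_ (tgt_mem_unitaryGroup p e i))
      exact ih _ hcard

/-- `ρ(e_x)² = χ(x,x)·1`. -/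
theorem trep_blade_mul_self (x : Blade n) :
    trep p e (bladeVec ℂ x) * trep p e (bladeVec ℂ x) = chi ℂ p x x • (1 : Matrix (Blade k) (Blade k) ℂ) := by
  rw [trep_def, rep_blade_mul, blade_add_self, rep_one]
  rfl

/-- `ρ(e_x)† = χ(x,x) ρ(e_x)` (a unitary of order dividing 4). -/
theorem star_trep_blade (x : Blade n) :
    star (trep p e (bladeVec ℂ x)) = chi ℂ p x x • trep p e (bladeVec ℂ x) := by
  have hu : star (trep p e (bladeVec ℂ x)) * trep p e (bladeVec ℂ x) = 1 :=
    Matrix.mem_unitaryGroup_iff'.mp (trep_blade_mem_unitaryGroup p e x)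
  have hsq := trep_blade_mul_self p e x
  calc star (trep p e (bladeVec ℂ x))
      = star (trep p e (bladeVec ℂ x)) * ((chi ℂ p x x * chi ℂ p x x) • (1 : Matrix (Blade k) (Blade k) ℂ)) := by
          rw [chi_mul_self, one_smul, mul_one]
    _ = chi ℂ p x x • (star (trep p e (bladeVec ℂ x)) * trep p e (bladeVec ℂ x) * trep p e (bladeVec ℂ x)) := by
          rw [← smul_smul, ← hsq, mul_smul_comm, mul_assoc]
    _ = chi ℂ p x x • trep p e (bladeVec ℂ x) := by rw [hu, one_mul]

/-- Some coordinate of a non-zero blade index is set. -/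
theorem exists_apply_eq_true {z : Blade n} (hz : z ≠ 0) : ∃ i, z i = true := by
  by_contra h
  push Not at h
  exact hz (funext fun i => by simpa using h i)

/-- **Blades other than `e_∅` are traceless** in the representation. -/
theorem trace_trep_blade (z : Blade n) (hz : z ≠ 0) : (trep p e (bladeVec ℂ z)).trace = 0 := by
  -- conjugation by a target generator γᵢ
  have hconj : ∀ i : Fin n, tgt p e i * trep p e (bladeVec ℂ z) =
      ((-1 : ℂ) ^ (univ.filter fun j => z j = true ∧ j ∈ univ.erase i).card) •
        (trep p e (bladeVec ℂ z) * tgt p e i) := by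
    intro i
    rw [trep_def]
    refine conj_sign _ _ _ _ (tgt p e i) (univ.erase i) ?_ ?_ z
    · intro j hj
      have hne : i ≠ j := fun h => by simp [h] at hj
      exact eq_neg_of_add_eq_zero_left (tgt_anticomm p e i j hne)
    · intro j hj
      have : j = i := by simpa using hj
      rw [this]
  rcases Nat.even_or_odd ((univ.filter fun j => z j = true).card) with hm | hm
  · -- even support: conjugate by γᵢ with zᵢ = 1
    obtain ⟨i, hi⟩ := exists_apply_eq_true hz
    have hset : (univ.filter fun j => z j = true ∧ j ∈ univ.erase i) = (univ.filter fun j => z j = true).erase i := by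
      ext j; by_cases hj : j = i <;> simp [hj, hi]
    have hodd : Odd ((univ.filter fun j => z j = true ∧ j ∈ univ.erase i).card) := by
      rw [hset, Finset.card_erase_of_mem (by simpa using hi)]
      obtain ⟨r, hr⟩ := hm
      have hpos : 0 < (univ.filter fun j => z j = true).card :=
        Finset.card_pos.mpr ⟨i, by simpa using hi⟩
      exact ⟨r - 1, by omega⟩
    refine trace_eq_zero_of_anticomm (U := tgt p e i) (ε := sigWeight ℂ p i) ?_ ?_ ?_
    · rcases sigWeight_cases p i with h | h <;> rw [h] <;> norm_num
    · rw [tgt_mul_self, Algebra.algebraMap_eq_smul_one]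
    · rw [hconj i, hodd.neg_one_pow, neg_one_smul]
  · by_cases hall : ∃ i, z i = false
    · -- odd support with a free coordinate: conjugate by that γᵢ
      obtain ⟨i, hi⟩ := hall
      have hset : (univ.filter fun j => z j = true ∧ j ∈ univ.erase i) = (univ.filter fun j => z j = true) := by
        ext j; by_cases hj : j = i <;> simp [hj, hi]
      refine trace_eq_zero_of_anticomm (U := tgt p e i) (ε := sigWeight ℂ p i) ?_ ?_ ?_
      · rcases sigWeight_cases p i with h | h <;> rw [h] <;> norm_num
      · rw [tgt_mul_self, Algebra.algebraMap_eq_smul_one]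
      · rw [hconj i, hset, hm.neg_one_pow, neg_one_smul]
    · -- z = 1ⁿ with n odd: there is a model operator outside the target family
      push Not at hall
      have hall' : ∀ i, z i = true := fun i => by simpa using hall i
      have hn : (univ.filter fun j => z j = true).card = n := by
        rw [Finset.filter_true_of_mem fun j _ => hall' j, Finset.card_univ, Fintype.card_fin]
      have hsurj : ¬ Function.Surjective e := by
        intro hs
        have hcard := Fintype.card_of_bijective ⟨e.injective, hs⟩
        simp only [Fintype.card_fin, Fintype.card_sum] at hcard
        rw [hn] at hm
        exact (Nat.not_even_iff_odd.mpr hm) ⟨k, hcard⟩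
      obtain ⟨ι, hι⟩ : ∃ ι, ∀ i, e i ≠ ι := by
        by_contra hc
        apply hsurj
        intro ι
        by_contra hc'
        exact hc ⟨ι, fun i hi => hc' ⟨i, hi⟩⟩
      have hconj' : modelMat ι * trep p e (bladeVec ℂ z) =
          ((-1 : ℂ) ^ (univ.filter fun j => z j = true ∧ j ∈ (univ : Finset (Fin n))).card) •
            (trep p e (bladeVec ℂ z) * modelMat ι) := by
        rw [trep_def]
        refine conj_sign _ _ _ _ (modelMat ι) univ ?_ ?_ z
        · intro j _
          rw [tgt, mul_smul_comm, smul_mul_assoc, ← smul_neg]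
          congr 1
          exact eq_neg_of_add_eq_zero_left (modelMat_anticomm (Ne.symm (hι j)))
        · intro j hj; exact absurd (Finset.mem_univ j) hj
      have hset : (univ.filter fun j => z j = true ∧ j ∈ (univ : Finset (Fin n))) = (univ.filter fun j => z j = true) := by
        ext j; simp
      refine trace_eq_zero_of_anticomm (U := modelMat ι) (ε := modelSq ι) (modelSq_ne_zero ι) (modelMat_mul_self ι) ?_
      rw [hconj', hset, hm.neg_one_pow, neg_one_smul]

/-- `x ⊕ y = 0` only for `x = y`. -/
theorem eq_of_add_eq_zero {x y : Blade n} (h : x + y = 0) : x = y := by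
  have := blade_add_add_cancel x y
  rw [h, add_zero] at this
  exact this

/-- **Hilbert–Schmidt orthogonality of the blade images**: `tr(ρ(e_x)† ρ(e_y)) = 2ᵏ [x = y]`. -/
theorem trace_star_trep_blade_mul (x y : Blade n) :
    (star (trep p e (bladeVec ℂ x)) * trep p e (bladeVec ℂ y)).trace = if x = y then (2 : ℂ) ^ k else 0 := by
  by_cases hxy : x = y
  · subst hxy
    rw [if_pos rfl, Matrix.mem_unitaryGroup_iff'.mp (trep_blade_mem_unitaryGroup p e x), Matrix.trace_one,
      card_blade]
    push_cast; rfl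
  · have h0 := trace_trep_blade p e (x + y) (fun h => hxy (eq_of_add_eq_zero h))
    rw [trep_def] at h0
    rw [if_neg hxy, star_trep_blade, smul_mul_assoc]
    simp only [trep_def]
    rw [rep_blade_mul, smul_smul, Matrix.trace_smul, h0, smul_zero]

/-- **`‖ρ(a)‖_F² = 2ᵏ ‖a‖₂²`.** -/
theorem sum_norm_sq_trep (a : MV n ℂ) :
    ∑ s, ∑ t, ‖trep p e a s t‖ ^ 2 = 2 ^ k * ∑ x, ‖a x‖ ^ 2 := by
  have h : (((∑ s, ∑ t, ‖trep p e a s t‖ ^ 2 : ℝ)) : ℂ) = (((2 ^ k * ∑ x, ‖a x‖ ^ 2 : ℝ)) : ℂ) := by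
    rw [sum_norm_sq_eq_trace, trep_def, rep_eq_sum, star_sum, Finset.sum_mul_sum]
    simp_rw [star_smul, smul_mul_smul_comm, Matrix.trace_sum, Matrix.trace_smul, ← trep_def,
      trace_star_trep_blade_mul, smul_eq_mul, mul_ite, mul_zero, Finset.sum_ite_eq, Finset.mem_univ,
      if_true]
    push_cast
    rw [Finset.mul_sum]
    refine Finset.sum_congr rfl fun x _ => ?_
    rw [RCLike.star_def, ← Complex.conj_mul']
    ring
  exact_mod_cast h

include e in
/-- **The Hilbert–Schmidt inequality**: `2ᵏ ‖ab‖₂² ≤ (2ᵏ‖a‖₂²)(2ᵏ‖b‖₂²)`. -/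
theorem key_ineq (a b : MV n ℂ) :
    2 ^ k * ∑ z, ‖gp (sigWeight ℂ p) a b z‖ ^ 2 ≤
      (2 ^ k * ∑ x, ‖a x‖ ^ 2) * (2 ^ k * ∑ y, ‖b y‖ ^ 2) := by
  rw [← sum_norm_sq_trep p e, ← sum_norm_sq_trep p e, ← sum_norm_sq_trep p e, trep_def, rep_mul,
    ← trep_def, ← trep_def]
  exact sum_norm_sq_mul_le _ _

end Target

/-! ### 5. Theorem A118-A and the success-probability ceiling -/

/-- **Theorem A118-A (general form).** For every signature `(p, n − p)` and every `k` with
`n ≤ 2k`: `Σ_z |c_z|² ≤ 2ᵏ · (Σ_x |a_x|²)(Σ_y |b_y|²)` for the Clifford product `c = a ·_χ b`. -/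
theorem sum_norm_sq_twConv_le_pow (p k : ℕ) (hk : n ≤ k + k) (a b : MV n ℂ) :
    ∑ z, ‖twConv (sigWeight ℂ p) a b z‖ ^ 2 ≤ 2 ^ k * ((∑ x, ‖a x‖ ^ 2) * ∑ y, ‖b y‖ ^ 2) := by
  let e : Fin n ↪ Fin k ⊕ Fin k := (Fin.castLEEmb hk).trans finSumFinEquiv.symm.toEmbedding
  have h := key_ineq p e a b
  rw [gp_eq_twConv] at h
  have hpos : (0 : ℝ) < 2 ^ k := by positivity
  nlinarith [h, hpos, Finset.sum_nonneg (fun z (_ : z ∈ (univ : Finset (Blade n))) => sq_nonneg ‖twConv (sigWeight ℂ p) a b z‖)]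

/-- **Theorem A118-A (DEQ-A118).** `‖AB‖₂² ≤ 2^{⌈n/2⌉} ‖A‖₂² ‖B‖₂²` for all `A, B ∈ Cℓ_{p,q}(ℂ)`,
`n = p + q`, in the blade-coefficient `ℓ²` norms. -/
theorem sum_norm_sq_twConv_le_ceil (p : ℕ) (a b : MV n ℂ) :
    ∑ z, ‖twConv (sigWeight ℂ p) a b z‖ ^ 2 ≤ 2 ^ ((n + 1) / 2) * ((∑ x, ‖a x‖ ^ 2) * ∑ y, ‖b y‖ ^ 2) :=
  sum_norm_sq_twConv_le_pow p ((n + 1) / 2) (by omega) a b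

/-- **Corollary (success-probability ceiling).** For normalised inputs the success probability
`p₀ = 2^{-n} Σ_z |c_z|²` of the post-selected branch of Muchane's Theorem 2.5 satisfies
`p₀ ≤ 2^{-⌊n/2⌋}`, for every input pair and every signature. -/
theorem successProbability_le_ceiling (p : ℕ) (a b : MV n ℂ)
    (ha : ∑ x : Blade n, ‖a x‖ ^ 2 = 1) (hb : ∑ y : Blade n, ‖b y‖ ^ 2 = 1) :
    ((2 : ℝ) ^ n)⁻¹ * ∑ z, ‖twConv (sigWeight ℂ p) a b z‖ ^ 2 ≤ ((2 : ℝ) ^ (n / 2))⁻¹ := by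
  have h := sum_norm_sq_twConv_le_ceil p a b
  rw [ha, hb, mul_one, mul_one] at h
  have hn : (2 : ℝ) ^ n = 2 ^ (n / 2) * 2 ^ ((n + 1) / 2) := by
    rw [← pow_add]; congr 1; omega
  rw [hn, mul_inv, mul_assoc]
  calc (2 ^ (n / 2) : ℝ)⁻¹ * ((2 ^ ((n + 1) / 2))⁻¹ * ∑ z, ‖twConv (sigWeight ℂ p) a b z‖ ^ 2)
      ≤ (2 ^ (n / 2) : ℝ)⁻¹ * 1 := by
        gcongr
        rw [inv_mul_le_iff₀ (by positivity), mul_one]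
        exact h
    _ = ((2 : ℝ) ^ (n / 2))⁻¹ := mul_one _

/-! ### 6. Tightness at `n = 1` -/

/-- Sums over the two blades of `(ℤ/2)¹`. -/
theorem sum_blade_one (f : Blade 1 → ℝ) : ∑ z : Blade 1, f z = f (fun _ => true) + f (fun _ => false) := by
  rw [← Fintype.sum_equiv (Equiv.funUnique (Fin 1) Bool).symm (fun b => f (fun _ => b)) f (fun b => rfl),
    Fintype.sum_bool]

/-- Sums over the two blades of `(ℤ/2)¹`, complex-valued. -/
theorem sum_blade_one' (f : Blade 1 → ℂ) : ∑ z : Blade 1, f z = f (fun _ => true) + f (fun _ => false) := by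
  rw [← Fintype.sum_equiv (Equiv.funUnique (Fin 1) Bool).symm (fun b => f (fun _ => b)) f (fun b => rfl),
    Fintype.sum_bool]

/-- In `(ℤ/2)¹` the all-ones index is the generator `δ₀`. -/
theorem blade_one_true_eq_gen : (fun _ : Fin 1 => true) = gen (0 : Fin 1) := by
  funext i; rw [Subsingleton.elim i 0]; simp [gen]

/-- **Tightness of Theorem A118-A at `n = 1`** (`Cℓ_{1,0}`, `e₁² = 1`): for `a = b = e_∅ + e₁` one has
`c = a·b = 2e_∅ + 2e₁`, so `Σ|c_z|² = 8 = 2^{⌈1/2⌉}·‖a‖₂²·‖b‖₂²`. -/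
theorem ceiling_attained_one :
    ∑ z : Blade 1, ‖twConv (sigWeight ℂ 1) (fun _ => (1 : ℂ)) (fun _ => (1 : ℂ)) z‖ ^ 2 =
      2 ^ ((1 + 1) / 2) * ((∑ x : Blade 1, ‖(fun _ => (1 : ℂ)) x‖ ^ 2) * ∑ y : Blade 1, ‖(fun _ => (1 : ℂ)) y‖ ^ 2) := by
  have hT : ∀ z : Blade 1, twConv (sigWeight ℂ 1) (fun _ => (1 : ℂ)) (fun _ => (1 : ℂ)) z = 2 := by
    intro z
    simp only [twConv, one_mul]
    rw [sum_blade_one']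
    have h0 : (fun _ : Fin 1 => false) = (0 : Blade 1) := rfl
    rw [h0, twist_zero_left, blade_one_true_eq_gen]
    -- twist (gen 0) (gen 0 + z): z is 0 or gen 0
    have hz : z = 0 ∨ z = gen (0 : Fin 1) := by
      rcases Bool.eq_false_or_eq_true (z 0) with h | h
      · right; rw [← blade_one_true_eq_gen]; funext i; rw [Subsingleton.elim i 0, h]
      · left; funext i; rw [Subsingleton.elim i 0, h]; rfl
    rcases hz with rfl | rfl
    · rw [add_zero, twist_gen_self]; simp [sigWeight]; norm_num
    · have : gen (0 : Fin 1) + gen 0 = 0 := by funext i; exact BooleanRing.add_self _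
      rw [this, twist_zero_right]; norm_num
  simp_rw [hT]
  rw [sum_blade_one, sum_blade_one]
  norm_num


end Summit.QuantumAdvantage.Dequantization.CliffordNormCeiling
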